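import Literature.Geometry.Kaehler.MatrixFormLocalCalculus
import Literature.Geometry.Kaehler.ConnectionExists
import HarnessLib

/-!
# Gauge covariance of the curvature of a connection on a cocycle; frame independence of `tr(Ωᵖ)`

Layer `Literature/Geometry/Kaehler`. Third file of the Chern–Weil package for `C^∞` complex vector
bundles presented by cocycles (`ComplexVectorBundle`: `SmoothComplexVectorBundle`, `Connection`,
`curvature`, `chernCharacterForm`; algebra and local calculus in `MatrixFormAlgebra`,
`MatrixFormLocalCalculus`). Kobayashi, *Differential Geometry of Complex Vector Bundles* (1987),
Ch. I §1, verbatim: "(1.16) `ω_U = g_{VU}⁻¹ ω_V g_{VU} + g_{VU}⁻¹ dg_{VU}` on `U ∩ V` […]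
(1.17) `Ω_U = g_{VU}⁻¹ Ω_V g_{VU}` on `U ∩ V`", and Ch. II §§1–2: the forms `tr(Ωᵏ)` are
therefore independent of the frame and define global forms ((2.1), (2.21)). All PROVED here,
pointwise at the points of `U_i ∩ U_j` (the connection forms being smooth, and the gauge law
holding, only there):

* `MatrixForm.gauge_curvature_apply` — the abstract computation behind (1.17): if near `x` a matrix
  of `1`-forms `P` equals `G ω K + G dK` with `G K = 1` near `x` and `K(x) G(x) = 1`, then
  `(dP + P ∧ P)(x) = (G (dω + ω ∧ ω) K)(x)` (Leibniz rules of `MatrixFormLocalCalculus`; the terms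
  in `dG`, `dK` cancel in pairs via `dG = -G dK G`, `d dK = 0`);
* `Connection.curvature_apply_eq_gauge` — **(1.17)** for a connection on a cocycle: for
  `x ∈ U_i ∩ U_j`, `Ω_j(x) = (g_ji Ω_i g_ij)(x)`; `Connection.npow_curvature_apply_eq_gauge` — the
  same for the wedge powers `Ωᵖ`;
* `Connection.trace_npow_curvature_apply_eq`, `Connection.chernCharacterForm_apply_eq` —
  **frame independence**: for `x ∈ U_i ∩ U_j`, `tr(Ω_jᵖ)(x) = tr(Ω_iᵖ)(x)` and
  `ch_p(E, D)|_{U_j}(x) = ch_p(E, D)|_{U_i}(x)` (cyclic invariance of the trace under function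
  factors, `trace_mulLeft`, and `g_ij g_ji = 1`);
* smoothness at the points of `U_i` of the entries of `ω_i`, `dω_i`, `Ω_i`, `Ω_iᵖ`.

## References

* S. Kobayashi, *Differential Geometry of Complex Vector Bundles* (1987), Ch. I §1 (1.12)–(1.17),
  Ch. II §1 (2.1), §2 (2.21).
-/

noncomputable section

open scoped Manifold ContDiff Topology Matrix
open Set Filter

namespace Literature.Geometry.Kaehler

/-! ### The abstract gauge computation -/

namespace MatrixForm

variable {E : Type*} [NormedAddCommGroup E] [NormedSpace ℝ E]
  {H : Type*} [TopologicalSpace H] {I : ModelWithCorners ℝ E H}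
  {M : Type*} [TopologicalSpace M] [ChartedSpace H M] {r k : ℕ}

/-- `(-A) · g = -(A · g)`. [folklore] -/
theorem neg_mulRight (A : MatrixForm I M r k) (g : M → Matrix (Fin r) (Fin r) ℂ) :
    (-A).mulRight g = -(A.mulRight g) := by
  ext a b x : 2
  simp only [mulRight_apply, Matrix.neg_apply, Pi.neg_apply, smul_neg, Finset.sum_neg_distrib]

/-- `g · (-A) = -(g · A)`. [folklore] -/
theorem mulLeft_neg (g : M → Matrix (Fin r) (Fin r) ℂ) (A : MatrixForm I M r k) :
    mulLeft g (-A) = -(mulLeft g A) := by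
  ext a b x : 2
  simp only [mulLeft_apply, Matrix.neg_apply, Pi.neg_apply, smul_neg, Finset.sum_neg_distrib]

/-- **`dG = -G (dK) G` at `x`** for matrix-valued functions with `G K = 1` near `x` and
`K(x) G(x) = 1` (differentiate `G K = 1`, a product of `0`-forms, `d1 = 0`, and multiply by `G` on
the right): `d(ofFun G)(x) = -(G · (d(ofFun K) · G))(x)`. [cite: Kobayashi1987, Ch. I §1 (1.16)–(1.17)] -/
theorem d_ofFun_apply_of_mul_eq_one {G K : M → Matrix (Fin r) (Fin r) ℂ} {x : M}
    (hG : ∀ c d, ContMDiffAt I 𝓘(ℝ, ℂ) ∞ (fun y ↦ G y c d) x)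
    (hK : ∀ c d, ContMDiffAt I 𝓘(ℝ, ℂ) ∞ (fun y ↦ K y c d) x)
    (hGK : ∀ᶠ y in 𝓝 x, G y * K y = 1) (hKG : K x * G x = 1) (a b : Fin r) :
    (ofFun (I := I) G).d a b x = -(mulLeft G ((ofFun (I := I) K).d.mulRight G)) a b x := by
  -- `d(G K) = 0` at `x`, entrywise
  have h1 : ∀ c d, (ofFun (I := I) (G * K)).d c d x = 0 := by
    intro c d
    rw [d_apply, ofFun_apply]
    have hev : ∀ᶠ y in 𝓝 x, (MForm.ofFun I fun y ↦ (G * K) y c d) y =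
        (MForm.ofFun I fun _ : M ↦ (1 : Matrix (Fin r) (Fin r) ℂ) c d) y := by
      filter_upwards [hGK] with y hy
      ext v
      simp only [MForm.ofFun_apply, Pi.mul_apply, hy]
    rw [mextDeriv_congr_of_eventuallyEq hev, mextDeriv_ofFun_const]
    rfl
  -- expand `d((ofFun G) · K) = 0` by the Leibniz rule: `(dG · K)(x) = -(G · dK)(x)`
  have h2 : ∀ c d, ((ofFun (I := I) G).d.mulRight K) c d x =
      -(mulLeft G (ofFun (I := I) K).d) c d x := by
    intro c d
    have h := h1 c d
    rw [ofFun_mul', d_mulRight_apply (smoothAt_ofFun hG) hK, pow_zero, one_smul, ofFun_wedge,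
      castDeg_eq_self] at h
    exact eq_neg_of_add_eq_zero_left h
  -- multiply by `G` on the right
  rw [← mulRight_apply_of_eq_one (g := K * G) (show (K * G) x = 1 from hKG) ((ofFun (I := I) G).d) a b,
    ← mulRight_mulRight, mulRight_apply,
    Finset.sum_congr rfl fun c _ ↦ by rw [h2 a c], ← mulLeft_mulRight]
  simp only [smul_neg, Finset.sum_neg_distrib, mulRight_apply]

variable [IsManifold I ∞ M]

/-- **The gauge computation behind Kobayashi (1.17).** Let `w`, `P` be matrices of `1`-forms and
`G`, `K` matrix-valued functions, all smooth at `x` (`K` near `x`), with `G K = 1` near `x`,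
`K(x) G(x) = 1`, and `P = G w K + G dK` near `x` (the gauge law (1.16) for `P = ω_j`, `w = ω_i`,
`G = g_ji`, `K = g_ij`). Then `(dP + P ∧ P)(x) = (G (dw + w ∧ w) K)(x)`: by the Leibniz rules,
`dP = dG ∧ w K + G dw K - G w ∧ dK + dG ∧ dK` and
`P ∧ P = G (w ∧ w) K + G w ∧ dK + G (dK G ∧ w) K + G (dK G ∧ dK)` at `x` (using `K G = 1`), and
`dG = -G dK G` makes the `dG`-terms cancel the last two. [cite: Kobayashi1987, Ch. I §1 (1.17)] -/
theorem gauge_curvature_apply {w P : MatrixForm I M r 1} {G K : M → Matrix (Fin r) (Fin r) ℂ}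
    {x : M} (hw : ∀ c d, (w c d).SmoothAt x)
    (hG : ∀ c d, ContMDiffAt I 𝓘(ℝ, ℂ) ∞ (fun y ↦ G y c d) x)
    (hK : ∀ᶠ y in 𝓝 x, ∀ c d, ContMDiffAt I 𝓘(ℝ, ℂ) ∞ (fun y ↦ K y c d) y)
    (hGK : ∀ᶠ y in 𝓝 x, G y * K y = 1) (hKG : K x * G x = 1)
    (hP : ∀ c d, ∀ᶠ y in 𝓝 x,
      P c d y = ((mulLeft G w).mulRight K + mulLeft G (ofFun (I := I) K).d) c d y)
    (a b : Fin r) :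
    (P.d + P.wedge P) a b x = (mulLeft G ((w.d + w.wedge w).mulRight K)) a b x := by
  set dK : MatrixForm I M r 1 := (ofFun (I := I) K).d with hdKdef
  set dG : MatrixForm I M r 1 := (ofFun (I := I) G).d with hdGdef
  set T : MatrixForm I M r 1 := (mulLeft G w).mulRight K with hTdef
  set S : MatrixForm I M r 1 := mulLeft G dK with hSdef
  -- smoothness at `x`
  have hKx : ∀ c d, ContMDiffAt I 𝓘(ℝ, ℂ) ∞ (fun y ↦ K y c d) x := hK.self_of_nhds
  have hdK : ∀ c d, (dK c d).SmoothAt x := fun c d ↦ by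
    rw [hdKdef, d_apply]
    exact MForm.SmoothAt.mextDeriv (hK.mono fun y hy ↦ smoothAt_ofFun hy c d)
  have hGw : ∀ c d, (mulLeft G w c d).SmoothAt x := smoothAt_mulLeft hG hw
  have hT : ∀ c d, (T c d).SmoothAt x := smoothAt_mulRight hGw hKx
  have hS : ∀ c d, (S c d).SmoothAt x := smoothAt_mulLeft hG hdK
  have hPx : ∀ c d, P c d x = (T + S) c d x := fun c d ↦ (hP c d).self_of_nhds
  -- (A) `(dP + P ∧ P)(x)` in terms of `T`, `S`
  have hA : (P.d + P.wedge P) a b x = (T.d a b x + S.d a b x) +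
      ((T.wedge T) a b x + (T.wedge S) a b x + ((S.wedge T) a b x + (S.wedge S) a b x)) := by
    rw [Matrix.add_apply, Pi.add_apply, d_apply, mextDeriv_congr_of_eventuallyEq (hP a b),
      ← d_apply, d_add_apply hT hS,
      wedge_apply_congr (A' := T + S) (B' := T + S) (fun c ↦ hPx a c) (fun c ↦ hPx c b),
      add_wedge, wedge_add, wedge_add]
    simp only [Matrix.add_apply, Pi.add_apply]
  -- (B) `dS = dG ∧ dK` at `x` (`d dK = 0`)
  have hddK : ∀ c d, dK.d c d x = 0 := fun c d ↦ by
    rw [d_apply, hdKdef, d_apply]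
    exact mextDeriv_mextDeriv_of_smoothAt (hK.mono fun y hy ↦ smoothAt_ofFun hy c d)
  have hdG : ∀ c d, dG c d x = -(mulLeft G (dK.mulRight G)) c d x := fun c d ↦
    d_ofFun_apply_of_mul_eq_one hG hKx hGK hKG c d
  have hB : S.d a b x = -(mulLeft G ((dK.mulRight G).wedge dK)) a b x := by
    rw [hSdef, d_mulLeft_apply hG hdK (by omega : 0 + 1 + 1 = 1 + 1), ← hdGdef, castDeg_eq_self,
      mulLeft_apply, Finset.sum_eq_zero fun c _ ↦ by rw [hddK c b, smul_zero], add_zero,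
      wedge_apply_congr (A' := -(mulLeft G (dK.mulRight G))) (B' := dK) (fun c ↦ hdG a c)
        (fun _ ↦ rfl),
      neg_wedge, ← mulLeft_wedge, Matrix.neg_apply, Pi.neg_apply]
  -- (C) `dT = dG ∧ w K + G dw K - G w ∧ dK` at `x`
  have hC : T.d a b x = -(mulLeft G (((dK.mulRight G).wedge w).mulRight K)) a b x +
      (mulLeft G (w.d.mulRight K)) a b x - ((mulLeft G w).wedge dK) a b x := by
    rw [hTdef, d_mulRight_apply hGw hKx, ← hdKdef, pow_one, neg_one_smul, Matrix.neg_apply,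
      Pi.neg_apply, ← sub_eq_add_neg]
    congr 1
    rw [mulRight_apply_congr_left K (A' := dG.wedge w + mulLeft G w.d) fun c ↦ by
        rw [d_mulLeft_apply hG hw (by omega : 0 + 1 + 1 = 1 + 1), ← hdGdef, castDeg_eq_self,
          Matrix.add_apply, Pi.add_apply],
      mulRight_add, Matrix.add_apply, Pi.add_apply, mulLeft_mulRight]
    congr 1
    rw [mulRight_apply_congr_left K (A' := -(mulLeft G ((dK.mulRight G).wedge w))) fun c ↦ by
        rw [wedge_apply_congr (A' := -(mulLeft G (dK.mulRight G))) (B' := w) (fun e ↦ hdG a e)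
          (fun _ ↦ rfl), neg_wedge, ← mulLeft_wedge],
      neg_mulRight, mulLeft_mulRight, Matrix.neg_apply, Pi.neg_apply]
  -- (F) the four wedge terms at `x`
  have hKG1 : ∀ (X : MatrixForm I M r 1) (c d : Fin r), mulLeft (K * G) X c d x = X c d x :=
    fun X c d ↦ mulLeft_apply_of_eq_one (g := K * G) (show (K * G) x = 1 from hKG) X c d
  have hF1 : (T.wedge T) a b x = (mulLeft G ((w.wedge w).mulRight K)) a b x := by
    rw [hTdef, mulRight_wedge, ← mulLeft_mulRight, mulLeft_mulLeft,
      wedge_apply_congr (A' := mulLeft G w) (B' := w.mulRight K) (fun _ ↦ rfl)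
        (fun c ↦ mulRight_apply_congr_left K fun e ↦ hKG1 w c e),
      ← mulLeft_wedge, ← wedge_mulRight]
  have hF2 : (T.wedge S) a b x = ((mulLeft G w).wedge dK) a b x := by
    rw [hTdef, hSdef, mulRight_wedge, mulLeft_mulLeft,
      wedge_apply_congr (A' := mulLeft G w) (B' := dK) (fun _ ↦ rfl) (fun c ↦ hKG1 dK c b)]
  have hF3 : (S.wedge T) a b x = (mulLeft G (((dK.mulRight G).wedge w).mulRight K)) a b x := by
    rw [hSdef, hTdef, ← mulLeft_wedge, ← wedge_mulRight, ← mulRight_wedge]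
  have hF4 : (S.wedge S) a b x = (mulLeft G ((dK.mulRight G).wedge dK)) a b x := by
    rw [hSdef, ← mulLeft_wedge, ← mulRight_wedge]
  -- (G) the right-hand side and the final cancellation
  have hR : (mulLeft G ((w.d + w.wedge w).mulRight K)) a b x =
      (mulLeft G (w.d.mulRight K)) a b x + (mulLeft G ((w.wedge w).mulRight K)) a b x := by
    rw [mulRight_add, mulLeft_add, Matrix.add_apply, Pi.add_apply]
  rw [hA, hB, hC, hF1, hF2, hF3, hF4, hR]
  abel

end MatrixForm

/-! ### Connections on cocycles -/

namespace SmoothComplexVectorBundle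

variable {ι : Type*} {E : Type*} [NormedAddCommGroup E] [NormedSpace ℂ E]
  {M : Type*} [TopologicalSpace M] [ChartedSpace E M] {r : ℕ}
  {V : SmoothComplexVectorBundle ι E M r}

/-- The overlap `U_i ∩ U_j` is a neighbourhood of each of its points. [folklore] -/
theorem inter_baseSet_mem_nhds (V : SmoothComplexVectorBundle ι E M r) {i j : ι} {x : M}
    (hi : x ∈ V.baseSet i) (hj : x ∈ V.baseSet j) : V.baseSet i ∩ V.baseSet j ∈ 𝓝 x :=
  ((V.isOpen_baseSet i).inter (V.isOpen_baseSet j)).mem_nhds ⟨hi, hj⟩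

namespace Connection

variable (D : V.Connection)

/-- The entries of the connection matrix `ω_i` are smooth at the points of `U_i`.
[cite: Kobayashi1987, Ch. I §1 (1.2)] -/
theorem smoothAt_form {i : ι} {x : M} (hi : x ∈ V.baseSet i) (a b : Fin r) :
    (D.form i a b).SmoothAt x :=
  D.isSmoothFormOn_form i a b x hi

/-- The entries of `ω_i` are smooth at all points near a point of `U_i`. [cite: Kobayashi1987, Ch. I §1 (1.2)] -/
theorem eventually_smoothAt_form {i : ι} {x : M} (hi : x ∈ V.baseSet i) (a b : Fin r) :
    ∀ᶠ y in 𝓝 x, (D.form i a b).SmoothAt y :=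
  eventually_of_mem ((V.isOpen_baseSet i).mem_nhds hi) fun _ hy ↦ D.smoothAt_form hy a b

variable [IsManifold 𝓘(ℝ, E) ∞ M]

/-- The entries of `dω_i` are smooth at the points of `U_i`. [cite: Kobayashi1987, Ch. I §1 (1.12)] -/
theorem smoothAt_form_d {i : ι} {x : M} (hi : x ∈ V.baseSet i) (a b : Fin r) :
    ((D.form i).d a b).SmoothAt x := by
  rw [MatrixForm.d_apply]
  exact MForm.SmoothAt.mextDeriv (D.eventually_smoothAt_form hi a b)

/-- The entries of the curvature matrix `Ω_i` are smooth at the points of `U_i`.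
[cite: Kobayashi1987, Ch. I §1 (1.12)] -/
theorem smoothAt_curvature {i : ι} {x : M} (hi : x ∈ V.baseSet i) (a b : Fin r) :
    (D.curvature i a b).SmoothAt x := by
  rw [curvature, Matrix.add_apply]
  exact (D.smoothAt_form_d hi a b).add
    (MatrixForm.smoothAt_wedge (D.smoothAt_form hi) (D.smoothAt_form hi) a b)

/-- The entries of the wedge powers `Ω_iᵖ` are smooth at the points of `U_i`.
[cite: Kobayashi1987, Ch. II §2 (2.21)] -/
theorem smoothAt_npow_curvature {i : ι} {x : M} (hi : x ∈ V.baseSet i) (p : ℕ) (a b : Fin r) :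
    (MatrixForm.npow (D.curvature i) p a b).SmoothAt x := by
  induction p generalizing a b with
  | zero =>
    rw [MatrixForm.npow_zero, MatrixForm.one, Matrix.diagonal_apply]
    split_ifs
    · exact MForm.smoothAt_ofFun_of_contMDiffAt contMDiffAt_const
    · exact MForm.smoothAt_zero x
  | succ p ih =>
    rw [MatrixForm.npow_succ]
    exact MatrixForm.smoothAt_castDeg _ (MatrixForm.smoothAt_wedge ih (D.smoothAt_curvature hi)) a b

/-- **Gauge covariance of the curvature, Kobayashi (1.17)**: at a point `x ∈ U_i ∩ U_j`,
`Ω_j(x) = (g_ji Ω_i g_ij)(x)` (`g_ji = g_ij⁻¹` there), from the gauge law (1.16) `form_eq` and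
the abstract computation `MatrixForm.gauge_curvature_apply`. [cite: Kobayashi1987, Ch. I §1 (1.17)] -/
theorem curvature_apply_eq_gauge {i j : ι} {x : M} (hi : x ∈ V.baseSet i) (hj : x ∈ V.baseSet j)
    (a b : Fin r) :
    D.curvature j a b x =
      (MatrixForm.mulLeft (V.coordChange j i) ((D.curvature i).mulRight (V.coordChange i j))) a b x := by
  have hW := V.inter_baseSet_mem_nhds hi hj
  have h := MatrixForm.gauge_curvature_apply (I := 𝓘(ℝ, E)) (w := D.form i) (P := D.form j)
    (G := V.coordChange j i) (K := V.coordChange i j) (x := x) (D.smoothAt_form hi)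
    (fun c d ↦ V.contMDiffAt_coordChange j i c d ⟨hj, hi⟩)
    (by filter_upwards [hW] with y hy; exact fun c d ↦ V.contMDiffAt_coordChange i j c d hy)
    (by filter_upwards [hW] with y hy; exact V.coordChange_mul_symm j i hy.2 hy.1)
    (V.coordChange_mul_symm i j hi hj)
    (fun c d ↦ by
      filter_upwards [hW] with y hy
      rw [D.form_eq i j y hy c d, Matrix.add_apply, Pi.add_apply]) a b
  rw [curvature, curvature]
  rw [Matrix.add_apply, Pi.add_apply] at h
  rw [Matrix.add_apply, Pi.add_apply]
  exact h

/-- The wedge powers of the curvature transform in the same way: at `x ∈ U_i ∩ U_j`,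
`Ω_jᵖ(x) = (g_ji Ω_iᵖ g_ij)(x)` (induction on `p`, the wedge being pointwise, `g_ij g_ji = 1`).
[cite: Kobayashi1987, Ch. I §1 (1.17)] -/
theorem npow_curvature_apply_eq_gauge {i j : ι} {x : M} (hi : x ∈ V.baseSet i)
    (hj : x ∈ V.baseSet j) (p : ℕ) (a b : Fin r) :
    MatrixForm.npow (D.curvature j) p a b x =
      (MatrixForm.mulLeft (V.coordChange j i)
        ((MatrixForm.npow (D.curvature i) p).mulRight (V.coordChange i j))) a b x := by
  induction p generalizing a b with
  | zero =>
    have hGK : V.coordChange j i x * V.coordChange i j x = 1 := V.coordChange_mul_symm j i hj hi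
    have hone : ∀ c d : Fin r, (MatrixForm.one : MatrixForm 𝓘(ℝ, E) M r 0) c d x =
        if c = d then MForm.ofFun 𝓘(ℝ, E) (fun _ : M ↦ (1 : ℂ)) x else 0 := by
      intro c d
      rw [MatrixForm.one, Matrix.diagonal_apply]
      split_ifs <;> rfl
    rw [MatrixForm.npow_zero, MatrixForm.npow_zero, MatrixForm.mulLeft_apply]
    simp only [MatrixForm.mulRight_apply, smul_smul, hone, smul_ite, smul_zero, Finset.sum_ite_eq,
      Finset.mem_univ, if_true]
    rw [← Finset.sum_smul, ← Matrix.mul_apply, hGK, Matrix.one_apply]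
    simp only [ite_smul, one_smul, zero_smul]
  | succ p ih =>
    have hKG : (V.coordChange i j * V.coordChange j i) x = 1 := V.coordChange_mul_symm i j hi hj
    rw [MatrixForm.npow_succ, MatrixForm.castDeg_eq_self,
      MatrixForm.wedge_apply_congr
        (A' := (MatrixForm.mulLeft (V.coordChange j i) (MatrixForm.npow (D.curvature i) p)).mulRight
          (V.coordChange i j))
        (B' := MatrixForm.mulLeft (V.coordChange j i) ((D.curvature i).mulRight (V.coordChange i j)))
        (fun c ↦ by rw [ih a c, MatrixForm.mulLeft_mulRight])
        (fun c ↦ D.curvature_apply_eq_gauge hi hj c b),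
      MatrixForm.mulRight_wedge, MatrixForm.mulLeft_mulLeft,
      MatrixForm.wedge_apply_congr
        (A' := MatrixForm.mulLeft (V.coordChange j i) (MatrixForm.npow (D.curvature i) p))
        (B' := (D.curvature i).mulRight (V.coordChange i j)) (fun _ ↦ rfl)
        (fun c ↦ MatrixForm.mulLeft_apply_of_eq_one hKG _ c b),
      ← MatrixForm.mulLeft_wedge, ← MatrixForm.wedge_mulRight, MatrixForm.npow_succ,
      MatrixForm.castDeg_eq_self]

/-- **Frame independence of `tr(Ωᵖ)`**: at `x ∈ U_i ∩ U_j`, `tr(Ω_jᵖ)(x) = tr(Ω_iᵖ)(x)`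
(`tr(g⁻¹ A g) = tr(A g g⁻¹) = tr(A)`; Kobayashi, Ch. II §1: invariant polynomials of the curvature
define global forms). [cite: Kobayashi1987, Ch. II §1 (2.1)] -/
theorem trace_npow_curvature_apply_eq {i j : ι} {x : M} (hi : x ∈ V.baseSet i)
    (hj : x ∈ V.baseSet j) (p : ℕ) :
    (MatrixForm.npow (D.curvature j) p).trace x = (MatrixForm.npow (D.curvature i) p).trace x := by
  have hKG : (V.coordChange i j * V.coordChange j i) x = 1 := V.coordChange_mul_symm i j hi hj
  have h1 : (MatrixForm.npow (D.curvature j) p).trace x =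
      (MatrixForm.mulLeft (V.coordChange j i)
        ((MatrixForm.npow (D.curvature i) p).mulRight (V.coordChange i j))).trace x := by
    simp only [Matrix.trace, Matrix.diag_apply, Finset.sum_apply]
    exact Finset.sum_congr rfl fun a _ ↦ D.npow_curvature_apply_eq_gauge hi hj p a a
  rw [h1, MatrixForm.trace_mulLeft, MatrixForm.mulRight_mulRight]
  simp only [Matrix.trace, Matrix.diag_apply, Finset.sum_apply]
  exact Finset.sum_congr rfl fun a _ ↦ MatrixForm.mulRight_apply_of_eq_one hKG _ a a

/-- **Frame independence of the Chern character forms**: at `x ∈ U_i ∩ U_j` the `p`-th Chern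
character forms computed in the frames `s_i` and `s_j` agree, `ch_p(E, D)|_{U_j}(x) = ch_p(E, D)|_{U_i}(x)`
(Kobayashi (2.21) with Ch. II §1). [cite: Kobayashi1987, Ch. II §2 (2.21)] -/
theorem chernCharacterForm_apply_eq {i j : ι} {x : M} (hi : x ∈ V.baseSet i)
    (hj : x ∈ V.baseSet j) (p : ℕ) :
    D.chernCharacterForm p j x = D.chernCharacterForm p i x := by
  simp only [chernCharacterForm, Pi.smul_apply, D.trace_npow_curvature_apply_eq hi hj p]

end Connection

end SmoothComplexVectorBundle

end Literature.Geometry.Kaehler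

end
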